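import Literature.Probability.RandomPlanarGeometry.SLEImageDriverEnvelope
import Literature.Probability.RandomPlanarGeometry.BrownianPathFreezingIntegrable
import HarnessLib

/-!
# Conditional one-step estimates of the image driving value `W̃` at `κ = 6` ([LSW] §5, locality of SLE₆)

G. F. Lawler, O. Schramm, W. Werner, *Conformal restriction: the chordal case*, J. Amer. Math. Soc.
**16** (2003) (**[LSW]**), §5, remark after (5.1): along the SLE_κ hulls and a `*`-hull `A` not yet
reached, the image driving value `W̃_t = h_t(W_t) = W_t + L_A − L_{B_t}` (`B_t = g_t(A) − W_t`,
`L_B = starShift B`) satisfies `dW̃_t = h_t'(W_t) dW_t + (κ/2 − 3) h_t''(W_t) dt`; at `κ = 6` the drift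
vanishes and `W̃` is a continuous local martingale with bracket `6 ∫ h_s'(W_s)² ds` (G. F. Lawler,
O. Schramm, W. Werner, Acta Math. **187** (2001), Thm. 2.2; G. F. Lawler (2005), §6.3 Prop. 6.13).
Here, in the conditional-increment language of the tree (twin of `SLERestrictionIncrementKappa` for the
UNBOUNDED functional `imageDrvFnK 6 A t = W̃_t − L_A` of `SLEImageDriverFunctional`): for a nonempty
`*`-hull `A`, a controlled class (`δ₀ ≤ Φ'_{B_u}(0)`, `B(0, 8ρ₀)` off `B_u`, `ρ₀ ≤ 1`), a horizon `T`,
there is `C = C(A, δ₀, ρ₀, T)` with, for `u ≤ T`, `192 h ≤ (δ₀ρ₀/4000)²` and every `𝓕_u`-measurable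
weight `g : Ω → [0, 1]` supported in the class,

  `|E[g (W̃_{u+h} − W̃_u)]| ≤ C h√h`,   `|E[g ((W̃_{u+h} − W̃_u)² − 6 Φ'_{B_u}(0)² h)]| ≤ C h√h`

(`exists_abs_integral_mul_imageDrv_sub_le`). Proof: freeze the past at `u`
(`integral_mul_eq_integral_integral_concat_of_integrable` of `BrownianPathFreezingIntegrable`, the
functional being integrable by the envelope of `SLEImageDriverEnvelope`); conditionally on the past, on
the good event `{√6 sup_{[0,h]}|β| ≤ c₀}` the frozen increment is the one-step increment
`Loewner.imageDriverStep (B_u) (√6 β) h` (`imageDrvFnK_concat_sub_eq_of_mem_goodEventK`) and everywhere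
it is dominated by `M₀(ω) + 3482√6 runSup h`, `M₀(ω) = 3482√6 sup_{[0,u]}|β(ω)| + 15080√(u+h) + 1160 R`,
so the deterministic-hull bounds `abs_integral_imageDriver_le_six`, `abs_integral_imageDriver_sq_sub_le`
(`SLEImageDriverOneStepVariance`) apply with constants affine/quadratic in `M₀(ω)`
(`exists_frozen_inner_le`); integrating `E sup_{[0,u]}|β| ≤ 2√u`, `E sup² ≤ 4u` gives `C(T)`.

**Why `C` depends on the horizon (`u ≤ T`) and not only on `(δ₀, ρ₀)`.** With the tree's convention
`imageDrvFnK = W_t` on dead paths (`LFnK := 0` once the hull meets `A`), the increment over a cell in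
which the frozen step kills `A` is `U_h + L_{B_u}`, and `L_B` is UNBOUNDED over the controlled class:
the slit `[x₀, x₀ + it]` has `Φ'(0) = x₀/√(x₀² + t²) = δ₀` and `L = x₀ (1/δ₀ − 1) → ∞` as `x₀ → ∞`,
and for the union of a thin plate `[8ρ₀, R] × [0, ε]` with such a slit at `R` one has `L ∼ R/δ₀`
while the SLE₆ step swallows a point of the plate by time `h` with probability `≥ ε(h, ρ₀) > 0`
independent of `R`; so the frozen conditional mean `L_{B_u} · P(death ≤ h) + O(√h)` is not bounded
uniformly over the class, and uniformity in `u` can only come from the law of `B_u` (here through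
`E sup_{[0,u]}|β| ≤ 2√u`). For the martingale assembly over a partition of `[s, t]` this is harmless
(`T = t`).

No named fact, no definition.

## References

* [LSW] 2003, §5, remark after (5.1). [LawlerSchrammWerner2003Restriction]
* G. F. Lawler (2005), §4.6.1, §6.3 Prop. 6.13. [Lawler2005]
* J.-F. Le Gall (2016), Prop. 2.5 (iii) (simple Markov property). [Legall2016]
-/

noncomputable section

open Set Filter Metric Function MeasureTheory
open _root_.Complex _root_.Topology
open Literature.Probability.Process
open scoped NNReal

namespace Literature.Probability.RandomPlanarGeometry

open Loewner PathOps

variable [MeasurableSpace C(ℝ≥0, ℝ)] [BorelSpace C(ℝ≥0, ℝ)]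

/-! ### The frozen inner expectations -/

section Inner

/-- **The frozen inner expectations, with constants uniform over the controlled class and affine /
quadratic in the envelope level.** There are `α₁, α₂, p ≥ 0` (depending on `δ₀, ρ₀` only) such that for
every nonempty `*`-hull `A ⊆ B̄(0, R)`, every past `ω` alive at `u` with `B = A_u − W_u` controlled, and
`192 h ≤ c₀²`: with `Z(ω₂) = ΔimageDrvFnK(concat_u(stop_u β(ω), β(ω₂)))` and
`M₀(ω) = 3482√6 runSup u ω + 15080√(u+h) + 1160 R`,
`|E Z| ≤ (α₁ + p M₀(ω)) h√h` (`abs_integral_imageDriver_le_six`) and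
`|E Z² − 6 Φ'_B(0)² h| ≤ (α₂ + 2p M₀(ω)²) h√h` (`abs_integral_imageDriver_sq_sub_le`).
[cite: LawlerSchrammWerner2003Restriction, §5 (remark after (5.1))] -/
theorem exists_frozen_inner_le {δ₀ ρ₀ : ℝ} (hδ0 : 0 < δ₀) (hρ₀ : 0 < ρ₀) (hρ1 : ρ₀ ≤ 1) :
    ∃ α₁ α₂ p : ℝ, 0 ≤ α₁ ∧ 0 ≤ α₂ ∧ 0 ≤ p ∧
      ∀ {A : Set ℂ}, IsStarHull A → ∀ {R : ℝ}, 0 < R → A ⊆ closedBall (0 : ℂ) R →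
        (∀ t, Measurable (imageDrvFnK 6 A t)) → ∀ {u h : ℝ≥0}, 0 < h → 192 * (h : ℝ) ≤ (δ₀ * ρ₀ / 4000) ^ 2 →
        ∀ {ω : ℝ≥0 → ℝ}, Disjoint (closedHull (drvK 6 (brownianCPath ω)) u) A →
          Disjoint (ball (0 : ℂ) (8 * ρ₀)) (slidHull (drvK 6 (brownianCPath ω)) A u) →
          δ₀ ≤ starDeriv (slidHull (drvK 6 (brownianCPath ω)) A u) →
        |∫ ω₂, (imageDrvFnK 6 A (u + h) (concat u (stop u (brownianCPath ω), brownianCPath ω₂)) -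
            imageDrvFnK 6 A u (concat u (stop u (brownianCPath ω), brownianCPath ω₂))) ∂preWienerMeasure| ≤
          (α₁ + p * (3482 * Real.sqrt 6 * runSup u ω + (15080 * Real.sqrt ((u + h : ℝ≥0) : ℝ) + 1160 * R))) * h * Real.sqrt h ∧
        |∫ ω₂, (imageDrvFnK 6 A (u + h) (concat u (stop u (brownianCPath ω), brownianCPath ω₂)) -
            imageDrvFnK 6 A u (concat u (stop u (brownianCPath ω), brownianCPath ω₂))) ^ 2 ∂preWienerMeasure -
            6 * starDeriv (slidHull (drvK 6 (brownianCPath ω)) A u) ^ 2 * h| ≤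
          (α₂ + 2 * p * (3482 * Real.sqrt 6 * runSup u ω + (15080 * Real.sqrt ((u + h : ℝ≥0) : ℝ) + 1160 * R)) ^ 2) *
            h * Real.sqrt h := by
  have hK0 : 0 ≤ stepK δ₀ ρ₀ := by rw [stepK]; positivity
  refine ⟨stepK δ₀ ρ₀ * (3 * Real.sqrt 6 + 5 + 2 * 6 * Real.sqrt 6) + 3 * (1 / ρ₀) * (128 * 6 ^ 2 / (δ₀ * ρ₀ / 4000) ^ 4) +
      2 * (3482 * Real.sqrt 6) * Real.sqrt (128 * 6 ^ 2 / (δ₀ * ρ₀ / 4000) ^ 4) +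
      Real.sqrt 6 * Real.sqrt (128 * 6 ^ 2 / (δ₀ * ρ₀ / 4000) ^ 4) +
      1 / ρ₀ * 6 * Real.sqrt (128 * 6 ^ 2 / (δ₀ * ρ₀ / 4000) ^ 4),
    2 * (7 * stepK δ₀ ρ₀ + 3 * (1 / ρ₀)) ^ 2 + 6 * (stepK δ₀ ρ₀ + 1 / ρ₀ / 2) ^ 2 * 6 ^ 2 +
      2 * (7 * stepK δ₀ ρ₀ + 3 * (1 / ρ₀)) * Real.sqrt 6 + 4 * (stepK δ₀ ρ₀ + 1 / ρ₀ / 2) * 6 * Real.sqrt 6 +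
      10 * (3482 * Real.sqrt 6) ^ 2 * Real.sqrt (128 * 6 ^ 2 / (δ₀ * ρ₀ / 4000) ^ 4) +
      2 * 6 * Real.sqrt (128 * 6 ^ 2 / (δ₀ * ρ₀ / 4000) ^ 4),
    128 * 6 ^ 2 / (δ₀ * ρ₀ / 4000) ^ 4, by positivity, by positivity, by positivity, ?_⟩
  intro A hA R hR0 hAR hmeas u h hh0 hh ω halive hBρ hδ
  set B := slidHull (drvK 6 (brownianCPath ω)) A u with hBdef
  have hB : IsStarHull B := Loewner.isStarHull_slidHull_of_disjoint (continuous_drvK 6 _) hA halive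
  set Φ : C(ℝ≥0, ℝ) → ℝ := fun υ ↦ imageDrvFnK 6 A (u + h) υ - imageDrvFnK 6 A u υ with hΦ
  have hΦm : Measurable Φ := (hmeas _).sub (hmeas _)
  set Z : (ℝ≥0 → ℝ) → ℝ := fun ω₂ ↦ Φ (concat u (stop u (brownianCPath ω), brownianCPath ω₂)) with hZ
  have hZm : Measurable Z := hΦm.comp ((measurable_concat u).comp (measurable_const.prodMk measurable_brownianCPath))
  set M₀ : ℝ := 3482 * Real.sqrt 6 * runSup u ω + (15080 * Real.sqrt ((u + h : ℝ≥0) : ℝ) + 1160 * R) with hM₀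
  obtain ⟨hd0, hd1, -⟩ := starDeriv_spec hB
  have hd : |starDeriv B| ≤ 1 := by rw [abs_of_pos hd0]; exact hd1
  obtain ⟨-, -, hc2, -, -⟩ := starJet_spec hB hρ₀ hBρ
  have hM₀0 : 0 ≤ M₀ := by have := runSup_nonneg u ω; positivity
  have hM₁0 : (0 : ℝ) ≤ 3482 * Real.sqrt 6 := by positivity
  have hh32 : 32 * (h : ℝ) ≤ (δ₀ * ρ₀ / 4000) ^ 2 := by have := h.coe_nonneg; linarith
  have hZeq : ∀ ω₂ ∈ goodEventK 6 (δ₀ * ρ₀ / 4000) h, Z ω₂ = imageDriverStep B (stepDriverK 6 ω₂) h := fun ω₂ hω₂ ↦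
    (imageDrvFnK_concat_sub_eq_of_mem_goodEventK hA halive hρ₀ hρ1 hBρ hδ0 hδ hh0 hh32 hω₂).2
  have hbad : ∀ ω₂, |Z ω₂| ≤ M₀ + 3482 * Real.sqrt 6 * runSup h ω₂ := fun ω₂ ↦
    abs_imageDrvFnK_concat_sub_le hA hR0 hAR u h ω ω₂
  have m1 := imageStepC_le_of_abs_le (κ := 6) (c := δ₀ * ρ₀ / 4000) (K := stepK δ₀ ρ₀) (M₀ := M₀)
    (M₁ := 3482 * Real.sqrt 6) (by norm_num) hd hc2
  have m2 := imageStepC₂_le_of_abs_le (κ := 6) (c := δ₀ * ρ₀ / 4000) (M₀ := M₀) (M₁ := 3482 * Real.sqrt 6)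
    (by norm_num) hK0 hd hc2
  constructor
  · calc _ ≤ _ := abs_integral_imageDriver_le_six hB hρ₀ hρ1 hBρ hδ0 hδ hh0 hh hM₀0 hM₁0 hZm hZeq hbad
      _ ≤ _ := by gcongr
  · have h6 : 32 * ((6 : ℝ≥0) : ℝ) * h ≤ (δ₀ * ρ₀ / 4000) ^ 2 := by push_cast; linarith
    have key := abs_integral_imageDriver_sq_sub_le hB hρ₀ hρ1 hBρ hδ0 hδ hh0 hh32 (by norm_num) h6 hM₀0 hM₁0 hZm hZeq hbad
    rw [show ((6 : ℝ≥0) : ℝ) = 6 by norm_num] at key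
    calc _ ≤ _ := key
      _ ≤ _ := by gcongr

end Inner

/-! ### Freezing with a weight, and integrating a pointwise bound -/

section Tools

/-- **Freezing with an `𝓕_u`-measurable weight**: for `g : Ω → [0, 1]` measurable for `𝓕_u` and `Φ`
measurable with `Φ ∘ β` integrable, the frozen conditional expectation
`Θ(ω) = E_{ω₂}[Φ(concat_u(stop_u β(ω), β(ω₂)))]` is integrable and `E[g Φ(β)] = E[g Θ]`
(Doob–Dynkin `exists_eq_comp_stop` and `integral_mul_eq_integral_integral_concat_of_integrable`).
[cite: Legall2016, Prop. 2.5 (iii)] -/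
theorem integral_mul_eq_integral_mul_concat_of_integrable {u : ℝ≥0} {g : (ℝ≥0 → ℝ) → ℝ}
    (hgm : Measurable[brownianFiltration u] g) (hg01 : ∀ ω, g ω ∈ Icc (0 : ℝ) 1) {Φ : C(ℝ≥0, ℝ) → ℝ}
    (hΦm : Measurable Φ) (hΦi : Integrable (fun ω ↦ Φ (brownianCPath ω)) preWienerMeasure) :
    Integrable (fun ω ↦ ∫ ω₂, Φ (concat u (stop u (brownianCPath ω), brownianCPath ω₂)) ∂preWienerMeasure) preWienerMeasure ∧
      ∫ ω, g ω * Φ (brownianCPath ω) ∂preWienerMeasure =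
        ∫ ω, g ω * (∫ ω₂, Φ (concat u (stop u (brownianCPath ω), brownianCPath ω₂)) ∂preWienerMeasure) ∂preWienerMeasure := by
  obtain ⟨H, hHm, hgH⟩ := exists_eq_comp_stop (u := u) hgm
  set H' : C(ℝ≥0, ℝ) → ℝ := fun υ ↦ max 0 (min (H υ) 1) with hH'
  have hH'm : Measurable H' := measurable_const.max (hHm.min measurable_const)
  have hH'b : ∀ υ, |H' υ| ≤ 1 := fun υ ↦ by
    rw [abs_le]; exact ⟨by linarith [le_max_left 0 (min (H υ) 1)], max_le zero_le_one (min_le_right _ _)⟩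
  have hgH' : ∀ ω, g ω = H' (stop u (brownianCPath ω)) := fun ω ↦ by
    rw [hH']; simp only
    rw [← hgH ω, min_eq_left (hg01 ω).2, max_eq_right (hg01 ω).1]
  obtain ⟨iΘ, hfr⟩ := integral_mul_eq_integral_integral_concat_of_integrable u hH'm hΦm hH'b hΦi
  refine ⟨iΘ, ?_⟩
  have e3 : (fun ω ↦ g ω * Φ (brownianCPath ω)) = fun ω ↦ H' (stop u (brownianCPath ω)) * Φ (brownianCPath ω) := by
    funext ω; rw [hgH' ω]
  have e4 : (fun ω ↦ g ω * ∫ ω₂, Φ (concat u (stop u (brownianCPath ω), brownianCPath ω₂)) ∂preWienerMeasure) =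
      fun ω ↦ H' (stop u (brownianCPath ω)) * ∫ ω₂, Φ (concat u (stop u (brownianCPath ω), brownianCPath ω₂)) ∂preWienerMeasure := by
    funext ω; rw [hgH' ω]
  rw [e3, e4]; exact hfr

omit [MeasurableSpace C(ℝ≥0, ℝ)] [BorelSpace C(ℝ≥0, ℝ)] in
/-- **Integrating a pointwise bound**: if `g Θ` is integrable and `|g Θ| ≤ a + b X` pointwise with `X`
integrable of integral `≤ I` and `b ≥ 0`, then `|E[g Θ]| ≤ a + b I`. [folklore] -/
theorem abs_integral_mul_le_of_abs_le {g Θ X : (ℝ≥0 → ℝ) → ℝ} {a b I : ℝ}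
    (igΘ : Integrable (fun ω ↦ g ω * Θ ω) preWienerMeasure) (hX : Integrable X preWienerMeasure) (hb : 0 ≤ b)
    (hI : ∫ ω, X ω ∂preWienerMeasure ≤ I) (hpt : ∀ ω, |g ω * Θ ω| ≤ a + b * X ω) :
    |∫ ω, g ω * Θ ω ∂preWienerMeasure| ≤ a + b * I := by
  haveI := isProbabilityMeasure_preWienerMeasure'
  have iB : Integrable (fun ω ↦ a + b * X ω) preWienerMeasure := (integrable_const a).add (hX.const_mul b)
  calc |∫ ω, g ω * Θ ω ∂preWienerMeasure| ≤ ∫ ω, |g ω * Θ ω| ∂preWienerMeasure := abs_integral_le_integral_abs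
    _ ≤ ∫ ω, (a + b * X ω) ∂preWienerMeasure := integral_mono igΘ.abs iB hpt
    _ = a + b * ∫ ω, X ω ∂preWienerMeasure := by
        rw [integral_add (integrable_const a) (hX.const_mul b), integral_const, integral_const_mul]; simp
    _ ≤ a + b * I := by gcongr

omit [MeasurableSpace C(ℝ≥0, ℝ)] [BorelSpace C(ℝ≥0, ℝ)] in
/-- Smallness: `192 h ≤ (δ₀ρ₀/4000)²` with `δ₀, ρ₀ ≤ 1` forces `h ≤ 1`. [folklore] -/
theorem coe_le_one_of_le {δ₀ ρ₀ : ℝ} {h : ℝ≥0} (hρ₀ : 0 < ρ₀) (hρ1 : ρ₀ ≤ 1) (hδ0 : 0 < δ₀) (hδ1 : δ₀ ≤ 1)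
    (hh : 192 * (h : ℝ) ≤ (δ₀ * ρ₀ / 4000) ^ 2) : (h : ℝ) ≤ 1 := by
  have hc1 : δ₀ * ρ₀ / 4000 ≤ 1 / 4000 := by
    rw [div_le_div_iff_of_pos_right (by norm_num)]
    have := mul_le_mul hδ1 hρ1 hρ₀.le zero_le_one
    linarith
  have h0 : (0 : ℝ) ≤ h := h.coe_nonneg
  nlinarith [mul_pos hδ0 hρ₀]

/-- The increment functional is measurable, and it and its square are integrable along the Brownian path
(envelope `abs_imageDrvFnK_brownianCPath_sub_le`, moments of `runSup`). [folklore] -/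
theorem integrable_imageDrv_sub {A : Set ℂ} (hA : IsStarHull A) (hmeas : ∀ t, Measurable (imageDrvFnK 6 A t)) {R : ℝ}
    (hR0 : 0 < R) (hAR : A ⊆ closedBall (0 : ℂ) R) (u h : ℝ≥0) :
    Measurable (fun υ : C(ℝ≥0, ℝ) ↦ imageDrvFnK 6 A (u + h) υ - imageDrvFnK 6 A u υ) ∧
    Integrable (fun ω ↦ imageDrvFnK 6 A (u + h) (brownianCPath ω) - imageDrvFnK 6 A u (brownianCPath ω)) preWienerMeasure ∧
      Integrable (fun ω ↦ (imageDrvFnK 6 A (u + h) (brownianCPath ω) - imageDrvFnK 6 A u (brownianCPath ω)) ^ 2)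
        preWienerMeasure := by
  set Φ : C(ℝ≥0, ℝ) → ℝ := fun υ ↦ imageDrvFnK 6 A (u + h) υ - imageDrvFnK 6 A u υ with hΦ
  have hΦm : Measurable Φ := (hmeas _).sub (hmeas _)
  set M₁ : ℝ := 3482 * Real.sqrt 6 with hM₁
  set Q : ℝ := 15080 * Real.sqrt ((u + h : ℝ≥0) : ℝ) + 1160 * R with hQ
  have hΦβ : ∀ ω, |Φ (brownianCPath ω)| ≤ M₁ * runSup (u + h) ω + Q := fun ω ↦
    abs_imageDrvFnK_brownianCPath_sub_le hA hR0 hAR u h ω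
  have hΦβm : Measurable fun ω ↦ Φ (brownianCPath ω) := hΦm.comp measurable_brownianCPath
  refine ⟨hΦm, (((integrable_runSup (u + h)).const_mul M₁).add (integrable_const Q)).mono' hΦβm.aestronglyMeasurable
      (Eventually.of_forall fun ω ↦ by rw [Real.norm_eq_abs]; exact hΦβ ω), ?_⟩
  refine ((((integrable_runSup_sq (u + h)).const_mul (2 * M₁ ^ 2)).add (integrable_const (2 * Q ^ 2))).mono'
    (hΦβm.pow_const 2).aestronglyMeasurable (Eventually.of_forall fun ω ↦ ?_))
  rw [Real.norm_eq_abs, abs_of_nonneg (sq_nonneg _), Pi.add_apply]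
  have h2 : Φ (brownianCPath ω) ^ 2 ≤ (M₁ * runSup (u + h) ω + Q) ^ 2 := by
    rw [← sq_abs]; exact pow_le_pow_left₀ (abs_nonneg _) (hΦβ ω) 2
  nlinarith [sq_nonneg (M₁ * runSup (u + h) ω - Q)]

end Tools

/-! ### The conditional one-step estimates -/

section Main

/-- **The first moment**: `|E[g (W̃_{u+h} − W̃_u)]| ≤ C h√h` for `u ≤ T`, `192 h ≤ c₀²`, `g` an
`𝓕_u`-measurable weight in `[0, 1]` supported in the controlled class.
[cite: LawlerSchrammWerner2003Restriction, §5 (remark after (5.1))] -/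
theorem exists_abs_integral_mul_imageDrv_sub_le_fst {A : Set ℂ} (hA : IsStarHull A) {δ₀ ρ₀ : ℝ} (hρ₀ : 0 < ρ₀)
    (hρ1 : ρ₀ ≤ 1) (hδ0 : 0 < δ₀) (hδ1 : δ₀ ≤ 1) (hmeas : ∀ t, Measurable (imageDrvFnK 6 A t)) (T : ℝ≥0) :
    ∃ C : ℝ, 0 ≤ C ∧ ∀ (u h : ℝ≥0), u ≤ T → 0 < h → 192 * (h : ℝ) ≤ (δ₀ * ρ₀ / 4000) ^ 2 →
      ∀ {g : (ℝ≥0 → ℝ) → ℝ}, Measurable[brownianFiltration u] g → (∀ ω, g ω ∈ Icc (0 : ℝ) 1) →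
        (∀ ω, g ω ≠ 0 → Disjoint (closedHull (drvK 6 (brownianCPath ω)) u) A ∧
          Disjoint (ball (0 : ℂ) (8 * ρ₀)) (slidHull (drvK 6 (brownianCPath ω)) A u) ∧
            δ₀ ≤ starDeriv (slidHull (drvK 6 (brownianCPath ω)) A u)) →
        |∫ ω, g ω * (imageDrvFnK 6 A (u + h) (brownianCPath ω) - imageDrvFnK 6 A u (brownianCPath ω))
            ∂preWienerMeasure| ≤ C * h * Real.sqrt h := by
  obtain ⟨R₁, hR₁⟩ := hA.isBoundedHull.isCompact.isBounded.subset_closedBall (0 : ℂ)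
  set R : ℝ := max R₁ 1 with hR
  have hR0 : 0 < R := lt_max_of_lt_right one_pos
  have hAR : A ⊆ closedBall (0 : ℂ) R := hR₁.trans (closedBall_subset_closedBall (le_max_left _ _))
  obtain ⟨α₁, α₂, p, hα₁, hα₂, hp, hinner⟩ := exists_frozen_inner_le hδ0 hρ₀ hρ1
  set Q₀ : ℝ := 15080 * Real.sqrt ((T : ℝ) + 1) + 1160 * R with hQ₀
  refine ⟨α₁ + p * Q₀ + p * (3482 * Real.sqrt 6) * (2 * Real.sqrt T), by positivity, ?_⟩
  intro u h huT hh0 hh g hgm hg01 hsupp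
  have hh1 := coe_le_one_of_le hρ₀ hρ1 hδ0 hδ1 hh
  have hhs0 : 0 ≤ (h : ℝ) * Real.sqrt h := mul_nonneg h.coe_nonneg (Real.sqrt_nonneg _)
  obtain ⟨hΦm, iΦ, -⟩ := integrable_imageDrv_sub hA hmeas hR0 hAR u h
  obtain ⟨iΘ, hfr⟩ := integral_mul_eq_integral_mul_concat_of_integrable hgm hg01 hΦm iΦ
  rw [hfr]
  have hgm' : Measurable g := hgm.mono (brownianFiltration.le u) le_rfl
  have hg1 : ∀ ω, |g ω| ≤ 1 := fun ω ↦ by rw [abs_of_nonneg (hg01 ω).1]; exact (hg01 ω).2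
  have hg1' : ∀ᵐ ω ∂preWienerMeasure, ‖g ω‖ ≤ 1 := Eventually.of_forall fun ω ↦ by rw [Real.norm_eq_abs]; exact hg1 ω
  have eR1 : ∫ ω, runSup u ω ∂preWienerMeasure ≤ 2 * Real.sqrt T := (integral_runSup_le u).trans (by gcongr)
  have hsq : Real.sqrt ((u + h : ℝ≥0) : ℝ) ≤ Real.sqrt ((T : ℝ) + 1) :=
    Real.sqrt_le_sqrt (by push_cast; exact add_le_add (by exact_mod_cast huT) hh1)
  have key := abs_integral_mul_le_of_abs_le (a := (α₁ + p * Q₀) * h * Real.sqrt h)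
    (b := p * (3482 * Real.sqrt 6) * h * Real.sqrt h) (iΘ.bdd_mul hgm'.aestronglyMeasurable hg1') (integrable_runSup u)
    (by positivity) eR1 fun ω ↦ ?_
  · exact key.trans (le_of_eq (by ring))
  · have hrhs0 : 0 ≤ (α₁ + p * Q₀) * h * Real.sqrt h + p * (3482 * Real.sqrt 6) * h * Real.sqrt h * runSup u ω := by
      have := runSup_nonneg u ω; positivity
    by_cases hω : g ω = 0
    · rw [hω, zero_mul, abs_zero]; exact hrhs0
    · obtain ⟨halive, hBρ, hδ⟩ := hsupp ω hω
      have h1 := (hinner hA hR0 hAR hmeas hh0 hh halive hBρ hδ).1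
      have m1 : 15080 * Real.sqrt ((u + h : ℝ≥0) : ℝ) + 1160 * R ≤ Q₀ := by rw [hQ₀]; linarith [hsq]
      rw [abs_mul]
      calc |g ω| * _ ≤ 1 * ((α₁ + p * (3482 * Real.sqrt 6 * runSup u ω + (15080 * Real.sqrt ((u + h : ℝ≥0) : ℝ) + 1160 * R))) *
            h * Real.sqrt h) := mul_le_mul (hg1 ω) h1 (abs_nonneg _) zero_le_one
        _ ≤ 1 * ((α₁ + p * (3482 * Real.sqrt 6 * runSup u ω + Q₀)) * h * Real.sqrt h) := by gcongr
        _ = _ := by ring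

/-- **The second moment**: `|E[g ((W̃_{u+h} − W̃_u)² − 6 Φ'_{B_u}(0)² h)]| ≤ C h√h` for `u ≤ T`,
`192 h ≤ c₀²`, `g` an `𝓕_u`-measurable weight in `[0, 1]` supported in the controlled class.
[cite: LawlerSchrammWerner2003Restriction, §5 (remark after (5.1))] -/
theorem exists_abs_integral_mul_imageDrv_sub_le_snd {A : Set ℂ} (hA : IsStarHull A) (hne : A.Nonempty) {δ₀ ρ₀ : ℝ}
    (hρ₀ : 0 < ρ₀) (hρ1 : ρ₀ ≤ 1) (hδ0 : 0 < δ₀) (hδ1 : δ₀ ≤ 1) (hmeas : ∀ t, Measurable (imageDrvFnK 6 A t)) (T : ℝ≥0) :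
    ∃ C : ℝ, 0 ≤ C ∧ ∀ (u h : ℝ≥0), u ≤ T → 0 < h → 192 * (h : ℝ) ≤ (δ₀ * ρ₀ / 4000) ^ 2 →
      ∀ {g : (ℝ≥0 → ℝ) → ℝ}, Measurable[brownianFiltration u] g → (∀ ω, g ω ∈ Icc (0 : ℝ) 1) →
        (∀ ω, g ω ≠ 0 → Disjoint (closedHull (drvK 6 (brownianCPath ω)) u) A ∧
          Disjoint (ball (0 : ℂ) (8 * ρ₀)) (slidHull (drvK 6 (brownianCPath ω)) A u) ∧
            δ₀ ≤ starDeriv (slidHull (drvK 6 (brownianCPath ω)) A u)) →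
        |∫ ω, g ω * ((imageDrvFnK 6 A (u + h) (brownianCPath ω) - imageDrvFnK 6 A u (brownianCPath ω)) ^ 2
            - 6 * starDeriv (slidHull (drvK 6 (brownianCPath ω)) A u) ^ 2 * h) ∂preWienerMeasure| ≤ C * h * Real.sqrt h := by
  haveI := isProbabilityMeasure_preWienerMeasure'
  obtain ⟨R₁, hR₁⟩ := hA.isBoundedHull.isCompact.isBounded.subset_closedBall (0 : ℂ)
  set R : ℝ := max R₁ 1 with hR
  have hR0 : 0 < R := lt_max_of_lt_right one_pos
  have hAR : A ⊆ closedBall (0 : ℂ) R := hR₁.trans (closedBall_subset_closedBall (le_max_left _ _))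
  obtain ⟨α₁, α₂, p, hα₁, hα₂, hp, hinner⟩ := exists_frozen_inner_le hδ0 hρ₀ hρ1
  set Q₀ : ℝ := 15080 * Real.sqrt ((T : ℝ) + 1) + 1160 * R with hQ₀
  refine ⟨α₂ + 4 * p * Q₀ ^ 2 + 4 * p * (3482 * Real.sqrt 6) ^ 2 * (4 * T), by positivity, ?_⟩
  intro u h huT hh0 hh g hgm hg01 hsupp
  have hh1 := coe_le_one_of_le hρ₀ hρ1 hδ0 hδ1 hh
  have hhs0 : 0 ≤ (h : ℝ) * Real.sqrt h := mul_nonneg h.coe_nonneg (Real.sqrt_nonneg _)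
  obtain ⟨hΦm, -, iΦ2⟩ := integrable_imageDrv_sub hA hmeas hR0 hAR u h
  obtain ⟨iΘ₂, hfr₂⟩ := integral_mul_eq_integral_mul_concat_of_integrable hgm hg01 (hΦm.pow_const 2) iΦ2
  have hgm' : Measurable g := hgm.mono (brownianFiltration.le u) le_rfl
  have hg1 : ∀ ω, |g ω| ≤ 1 := fun ω ↦ by rw [abs_of_nonneg (hg01 ω).1]; exact (hg01 ω).2
  have hg1' : ∀ᵐ ω ∂preWienerMeasure, ‖g ω‖ ≤ 1 := Eventually.of_forall fun ω ↦ by rw [Real.norm_eq_abs]; exact hg1 ω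
  set D : (ℝ≥0 → ℝ) → ℝ := fun ω ↦ 6 * starDeriv (slidHull (drvK 6 (brownianCPath ω)) A u) ^ 2 * h with hD
  set Θ₂ : (ℝ≥0 → ℝ) → ℝ := fun ω ↦ ∫ ω₂, (imageDrvFnK 6 A (u + h) (concat u (stop u (brownianCPath ω), brownianCPath ω₂)) -
    imageDrvFnK 6 A u (concat u (stop u (brownianCPath ω), brownianCPath ω₂))) ^ 2 ∂preWienerMeasure with hΘ₂
  -- measurability and integrability of `g · D` through `DFnK`
  have hgDm : Measurable fun ω ↦ g ω * D ω := by
    have h1 : (fun ω ↦ g ω * D ω) = fun ω ↦ g ω * (6 * DFnK 6 A u (brownianCPath ω) ^ 2 * h) := by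
      funext ω
      by_cases hg0 : g ω = 0
      · rw [hg0, zero_mul, zero_mul]
      · rw [hD, (DFnK_eq (κ := 6) (A := A) u (brownianCPath ω)).1 (hsupp ω hg0).1]
    rw [h1]
    exact hgm'.mul ((measurable_const.mul (((measurable_DFnK hA hne u).comp measurable_brownianCPath).pow_const _)).mul
      measurable_const)
  have hD01 : ∀ ω, 0 ≤ D ω ∧ D ω ≤ 6 := fun ω ↦ by
    obtain ⟨h0, h1⟩ := starDeriv_pos_le_one (slidHull (drvK 6 (brownianCPath ω)) A u)
    have : starDeriv (slidHull (drvK 6 (brownianCPath ω)) A u) ^ 2 ≤ 1 := by nlinarith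
    rw [hD]
    exact ⟨by positivity, by nlinarith⟩
  have igD : Integrable (fun ω ↦ g ω * D ω) preWienerMeasure :=
    (integrable_const (6 : ℝ)).mono' hgDm.aestronglyMeasurable (Eventually.of_forall fun ω ↦ by
      rw [Real.norm_eq_abs, abs_mul, abs_of_nonneg (hD01 ω).1]
      exact (mul_le_mul (hg1 ω) (hD01 ω).2 (hD01 ω).1 zero_le_one).trans_eq (one_mul _))
  have igΦ2 := iΦ2.bdd_mul hgm'.aestronglyMeasurable hg1'
  have igΘ₂ : Integrable (fun ω ↦ g ω * Θ₂ ω) preWienerMeasure := iΘ₂.bdd_mul hgm'.aestronglyMeasurable hg1'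
  -- through the freezing formula
  have hrw : ∫ ω, g ω * ((imageDrvFnK 6 A (u + h) (brownianCPath ω) - imageDrvFnK 6 A u (brownianCPath ω)) ^ 2 - D ω)
      ∂preWienerMeasure = ∫ ω, g ω * (Θ₂ ω - D ω) ∂preWienerMeasure := by
    have e1 : (fun ω ↦ g ω * ((imageDrvFnK 6 A (u + h) (brownianCPath ω) - imageDrvFnK 6 A u (brownianCPath ω)) ^ 2 - D ω)) =
        fun ω ↦ g ω * (imageDrvFnK 6 A (u + h) (brownianCPath ω) - imageDrvFnK 6 A u (brownianCPath ω)) ^ 2 - g ω * D ω := by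
      funext ω; ring
    have e2 : (fun ω ↦ g ω * (Θ₂ ω - D ω)) = fun ω ↦ g ω * Θ₂ ω - g ω * D ω := by funext ω; ring
    rw [e1, e2, integral_sub igΦ2 igD, integral_sub igΘ₂ igD, hfr₂]
  show |∫ ω, g ω * ((imageDrvFnK 6 A (u + h) (brownianCPath ω) - imageDrvFnK 6 A u (brownianCPath ω)) ^ 2 - D ω)
      ∂preWienerMeasure| ≤ _
  rw [hrw]
  have eR2 : ∫ ω, runSup u ω ^ 2 ∂preWienerMeasure ≤ 4 * T :=
    (integral_runSup_sq_le u).trans (by have : (u : ℝ) ≤ T := (by exact_mod_cast huT); linarith)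
  have hsq : Real.sqrt ((u + h : ℝ≥0) : ℝ) ≤ Real.sqrt ((T : ℝ) + 1) :=
    Real.sqrt_le_sqrt (by push_cast; exact add_le_add (by exact_mod_cast huT) hh1)
  have igΘD : Integrable (fun ω ↦ g ω * (Θ₂ ω - D ω)) preWienerMeasure :=
    (igΘ₂.sub igD).congr (Eventually.of_forall fun ω ↦ by simp only [Pi.sub_apply]; ring)
  have key := abs_integral_mul_le_of_abs_le (a := (α₂ + 4 * p * Q₀ ^ 2) * h * Real.sqrt h)
    (b := 4 * p * (3482 * Real.sqrt 6) ^ 2 * h * Real.sqrt h) igΘD (integrable_runSup_sq u) (by positivity) eR2 fun ω ↦ ?_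
  · exact key.trans (le_of_eq (by ring))
  · have hrhs0 : 0 ≤ (α₂ + 4 * p * Q₀ ^ 2) * h * Real.sqrt h + 4 * p * (3482 * Real.sqrt 6) ^ 2 * h * Real.sqrt h * runSup u ω ^ 2 := by
      positivity
    by_cases hω : g ω = 0
    · rw [hω, zero_mul, abs_zero]; exact hrhs0
    · obtain ⟨halive, hBρ, hδ⟩ := hsupp ω hω
      have h1 := (hinner hA hR0 hAR hmeas hh0 hh halive hBρ hδ).2
      have m0 : 0 ≤ 3482 * Real.sqrt 6 * runSup u ω + (15080 * Real.sqrt ((u + h : ℝ≥0) : ℝ) + 1160 * R) := by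
        have := runSup_nonneg u ω; positivity
      have m1 : 3482 * Real.sqrt 6 * runSup u ω + (15080 * Real.sqrt ((u + h : ℝ≥0) : ℝ) + 1160 * R) ≤
          3482 * Real.sqrt 6 * runSup u ω + Q₀ := by rw [hQ₀]; linarith
      have m2 : (3482 * Real.sqrt 6 * runSup u ω + (15080 * Real.sqrt ((u + h : ℝ≥0) : ℝ) + 1160 * R)) ^ 2 ≤
          2 * (3482 * Real.sqrt 6) ^ 2 * runSup u ω ^ 2 + 2 * Q₀ ^ 2 := by
        have := pow_le_pow_left₀ m0 m1 2
        nlinarith [sq_nonneg (3482 * Real.sqrt 6 * runSup u ω - Q₀)]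
      rw [abs_mul]
      calc |g ω| * _ ≤ 1 * ((α₂ + 2 * p * (3482 * Real.sqrt 6 * runSup u ω + (15080 * Real.sqrt ((u + h : ℝ≥0) : ℝ) + 1160 * R)) ^ 2) *
            h * Real.sqrt h) := mul_le_mul (hg1 ω) h1 (abs_nonneg _) zero_le_one
        _ ≤ 1 * ((α₂ + 2 * p * (2 * (3482 * Real.sqrt 6) ^ 2 * runSup u ω ^ 2 + 2 * Q₀ ^ 2)) * h * Real.sqrt h) := by
            gcongr
        _ = _ := by ring

/-- **[LSW] §5 at `κ = 6`, conditional-increment form (locality of SLE₆ for one step).** For a nonempty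
`*`-hull `A`, a controlled class (`δ₀ ≤ Φ'`, `B(0, 8ρ₀)` off the slid hull, `ρ₀ ≤ 1`) and a horizon `T`,
there is `C = C(A, δ₀, ρ₀, T)` such that for `u ≤ T`, a step `h` with `192 h ≤ (δ₀ρ₀/4000)²`, and every
`𝓕_u`-measurable weight `g : Ω → [0, 1]` supported where the path is alive at `u` with `A_u − W_u` in
the class,

  `|E[g · (W̃_{u+h} − W̃_u)]| ≤ C h √h`,  `|E[g · ((W̃_{u+h} − W̃_u)² − 6 Φ'_{A_u − W_u}(0)² h)]| ≤ C h √h`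

(`W̃_t − L_A = imageDrvFnK 6 A t`): the conditional increments of `W̃` under SLE₆ have mean `o(h)` and
variance `6 h_u'(W_u)² h + o(h)` — the one-step skeleton of "`W̃` is a continuous local martingale with
bracket `6 ∫ h_s'(W_s)² ds`". [cite: LawlerSchrammWerner2003Restriction, §5 (remark after (5.1))] -/
theorem exists_abs_integral_mul_imageDrv_sub_le {A : Set ℂ} (hA : IsStarHull A) (hne : A.Nonempty) {δ₀ ρ₀ : ℝ}
    (hρ₀ : 0 < ρ₀) (hρ1 : ρ₀ ≤ 1) (hδ0 : 0 < δ₀) (hδ1 : δ₀ ≤ 1) (hmeas : ∀ t, Measurable (imageDrvFnK 6 A t)) (T : ℝ≥0) :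
    ∃ C : ℝ, 0 ≤ C ∧ ∀ (u h : ℝ≥0), u ≤ T → 0 < h → 192 * (h : ℝ) ≤ (δ₀ * ρ₀ / 4000) ^ 2 →
      ∀ {g : (ℝ≥0 → ℝ) → ℝ}, Measurable[brownianFiltration u] g → (∀ ω, g ω ∈ Icc (0 : ℝ) 1) →
        (∀ ω, g ω ≠ 0 → Disjoint (closedHull (drvK 6 (brownianCPath ω)) u) A ∧
          Disjoint (ball (0 : ℂ) (8 * ρ₀)) (slidHull (drvK 6 (brownianCPath ω)) A u) ∧
            δ₀ ≤ starDeriv (slidHull (drvK 6 (brownianCPath ω)) A u)) →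
        |∫ ω, g ω * (imageDrvFnK 6 A (u + h) (brownianCPath ω) - imageDrvFnK 6 A u (brownianCPath ω))
            ∂preWienerMeasure| ≤ C * h * Real.sqrt h ∧
        |∫ ω, g ω * ((imageDrvFnK 6 A (u + h) (brownianCPath ω) - imageDrvFnK 6 A u (brownianCPath ω)) ^ 2
            - 6 * starDeriv (slidHull (drvK 6 (brownianCPath ω)) A u) ^ 2 * h) ∂preWienerMeasure|
          ≤ C * h * Real.sqrt h := by
  obtain ⟨C₁, hC₁, h₁⟩ := exists_abs_integral_mul_imageDrv_sub_le_fst hA hρ₀ hρ1 hδ0 hδ1 hmeas T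
  obtain ⟨C₂, -, h₂⟩ := exists_abs_integral_mul_imageDrv_sub_le_snd hA hne hρ₀ hρ1 hδ0 hδ1 hmeas T
  refine ⟨max C₁ C₂, le_max_of_le_left hC₁, ?_⟩
  intro u h huT hh0 hh g hgm hg01 hsupp
  have hhs0 : 0 ≤ (h : ℝ) * Real.sqrt h := mul_nonneg h.coe_nonneg (Real.sqrt_nonneg _)
  constructor
  · calc _ ≤ C₁ * h * Real.sqrt h := h₁ u h huT hh0 hh hgm hg01 hsupp
      _ ≤ max C₁ C₂ * h * Real.sqrt h := by rw [mul_assoc, mul_assoc]; exact mul_le_mul_of_nonneg_right (le_max_left _ _) hhs0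
  · calc _ ≤ C₂ * h * Real.sqrt h := h₂ u h huT hh0 hh hgm hg01 hsupp
      _ ≤ max C₁ C₂ * h * Real.sqrt h := by rw [mul_assoc, mul_assoc]; exact mul_le_mul_of_nonneg_right (le_max_right _ _) hhs0

end Main

end Literature.Probability.RandomPlanarGeometry

end
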